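import Summits.Schanuel.Schanuel.Theorems.EPiSimultaneousType.Negative.CoordinatewiseLinear

/-!
# `EPiSimultaneousTypeEv`: the window `1/2 ≤ a < 1` and the common-field clause survive the passage
to the EVENTUAL form, modulo the coordinatewise linear approximability of `(π, e)`
(negative lemmas for item `stmt-Schanuel-14975`, route DiophantineDichotomy)

Item 14975 (`EPiSimultaneousTypeEv`) relaxes item 6118 (`EPiSimultaneousType`) by a threshold
`H ≥ H₀(d)`: every bounded-height witness against 6118 (β-expansions, height-3 challengers of
`Negative/BoundedHeightHalf.lean`) leaves the kill surface. The UNBOUNDED-height family does not: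
hypothesis `hB` below (verbatim the one of `Negative/CoordinatewiseLinear.lean`) provides, for every
`n ≥ 1`, challengers of coordinatewise degree `≤ n` past ANY height threshold with
`max(|α₁ − π|, |α₂ − e|) ≤ H^{−cn}`. IN PRINT: Bugeaud, *Approximation simultanée par des nombres
algébriques*, J. Théor. Nombres Bordeaux 15 (2003) 665–672, quoted in Bugeaud, *Approximation by
Algebraic Numbers* (CUP 2004) §3.8 p. 94 ("If `ξ₁` or `ξ₂` is an S-number … the answer is positive
with `Ψ(n) = c₂₃ n`"), together with "`e` is an S-number" (Popken 1929 / Mahler 1932; ibid. p. 83).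
Not vendored in tree; taken as a hypothesis.

* `epiSimultaneousTypeEv_half_false_of_coordLinear` — modulo `hB`, NO witness `(a, b, C)` of the
  eventual item has `a < 1/2`: the pair of `hB` at level `n` is admissible at level `(n², H)` with
  `H ≥ H₀(n²)`, so `C (n²)ᵃ ≥ cn − 1` for all `n`.
* `epiSimultaneousTypeEv_false_without_fieldDegree_of_coordLinear` — modulo `hB`, the eventual
  item with the common-field clause `[ℚ(γ₁, γ₂):ℚ] ≤ d` DELETED is false for every `a < 1`.

So the eventual relaxation does not widen the target window of the item: `1/2 ≤ a < 1`, with the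
common-field clause load-bearing — exactly as for 6118. Everything is proved; no named facts.
-/

set_option linter.dupNamespace false

noncomputable section

namespace Summit.Schanuel.Schanuel.Theorems

open Polynomial
open scoped IntermediateField
open EPiSimultaneousType

/-- **`a ≥ 1/2` is necessary in `EPiSimultaneousTypeEv`, modulo the coordinatewise linear
approximability `hB` of `(π, e)`** (in print: Bugeaud 2003 + `e ∈ S`): the pair `(α₁, α₂)` of `hB`
at level `n`, taken past the threshold `H₀(n²)`, is admissible at level `(n², H)`, so the eventual
item with `a < 1/2` (everything else verbatim) is false. [folklore] -/
theorem epiSimultaneousTypeEv_half_false_of_coordLinear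
    (hB : ∃ c : ℝ, 0 < c ∧ ∀ n : ℕ, 1 ≤ n → ∀ H₀ : ℕ, ∃ H : ℕ, H₀ ≤ H ∧ ∃ α : Fin 2 → ℂ,
      (∀ i, ∃ P : Polynomial ℤ, P ≠ 0 ∧ P.natDegree ≤ n ∧ (∀ k, |P.coeff k| ≤ (H : ℤ)) ∧
        Polynomial.aeval (α i) P = 0) ∧
      ‖α - ![(Real.pi : ℂ), (Real.exp 1 : ℂ)]‖ ≤ (H : ℝ) ^ (-(c * n))) :
    ¬ ∃ a b C : ℝ, a < 1 / 2 ∧ 0 < C ∧ ∀ d : ℕ, ∃ H₀ : ℕ, ∀ (H : ℕ) (γ : Fin 2 → ℂ), H₀ ≤ H →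
      Module.finrank ℚ ↥(IntermediateField.adjoin ℚ (Set.range γ)) ≤ d →
      (∀ i, ∃ P : Polynomial ℤ, P ≠ 0 ∧ P.natDegree ≤ d ∧ (∀ k, |P.coeff k| ≤ (H : ℤ)) ∧
        Polynomial.aeval (γ i) P = 0) →
      Real.exp (-(C * ((d : ℝ) ^ a * Real.log H + (d : ℝ) ^ b))) ≤
        ‖γ - ![(Real.pi : ℂ), (Real.exp 1 : ℂ)]‖ := by
  rintro ⟨a, b, C, ha, hC, hM⟩
  obtain ⟨c, hc, hB⟩ := hB
  set e : ℝ := 2 * max a 0 with hedef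
  have he0 : 0 ≤ e := by rw [hedef]; positivity
  have he1 : e < 1 := by
    rw [hedef]
    have : max a 0 < 1 / 2 := max_lt ha (by norm_num)
    linarith
  have hae : 2 * a ≤ e := by rw [hedef]; linarith [le_max_left a 0]
  obtain ⟨n, hn1, hn⟩ := exists_nat_linear_beats_rpow (C' := C) hc he0 he1
  obtain ⟨H₀, hH₀⟩ := hM (n ^ 2)
  obtain ⟨H, hH0, α, hcl, hdist⟩ :=
    hB n hn1 (max H₀ (⌈Real.exp (C * ((n : ℝ) ^ 2) ^ b)⌉₊ + 2))
  have hH0' : H₀ ≤ H := (le_max_left _ _).trans hH0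
  have hH0'' : ⌈Real.exp (C * ((n : ℝ) ^ 2) ^ b)⌉₊ + 2 ≤ H := (le_max_right _ _).trans hH0
  have hn1' : (1 : ℝ) ≤ n := by exact_mod_cast hn1
  have hn0 : (0 : ℝ) < n := by linarith
  have hH2 : (2 : ℝ) ≤ H := by
    have : (2 : ℕ) ≤ H := le_trans (Nat.le_add_left 2 _) hH0''
    exact_mod_cast this
  have hHpos : (0 : ℝ) < H := by linarith
  have hlogH : C * ((n : ℝ) ^ 2) ^ b < Real.log H := by
    have h1 : Real.exp (C * ((n : ℝ) ^ 2) ^ b) ≤ ⌈Real.exp (C * ((n : ℝ) ^ 2) ^ b)⌉₊ :=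
      Nat.le_ceil _
    have h2 : ((⌈Real.exp (C * ((n : ℝ) ^ 2) ^ b)⌉₊ + 2 : ℕ) : ℝ) ≤ H := by exact_mod_cast hH0''
    push_cast at h2
    rw [← Real.exp_lt_exp, Real.exp_log hHpos]
    linarith
  -- admissible at level (n², H), past the threshold H₀(n²)
  have hfin : Module.finrank ℚ ↥(IntermediateField.adjoin ℚ (Set.range α)) ≤ n ^ 2 :=
    finrank_adjoin_pair_le hcl
  have hcl2 : ∀ i, ∃ P : Polynomial ℤ, P ≠ 0 ∧ P.natDegree ≤ n ^ 2 ∧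
      (∀ k, |P.coeff k| ≤ (H : ℤ)) ∧ Polynomial.aeval (α i) P = 0 := by
    intro i
    obtain ⟨P, hP0, hdeg, hHt, hroot⟩ := hcl i
    exact ⟨P, hP0, hdeg.trans (by nlinarith), hHt, hroot⟩
  have hmeas := hH₀ H α hH0' hfin hcl2
  have hcast : ((n ^ 2 : ℕ) : ℝ) = (n : ℝ) ^ 2 := by push_cast; ring
  rw [hcast] at hmeas
  have key : (H : ℝ) ^ (-(c * n)) <
      Real.exp (-(C * (((n : ℝ) ^ 2) ^ a * Real.log H + ((n : ℝ) ^ 2) ^ b))) := by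
    rw [Real.rpow_def_of_pos hHpos, Real.exp_lt_exp]
    have hna : ((n : ℝ) ^ 2) ^ a ≤ (n : ℝ) ^ e := by
      rw [show ((n : ℝ) ^ 2) = (n : ℝ) ^ (2 : ℝ) by norm_cast, ← Real.rpow_mul hn0.le]
      exact Real.rpow_le_rpow_of_exponent_le hn1' hae
    have hlog0 : 0 < Real.log H := Real.log_pos (by linarith)
    have h1 : C * (((n : ℝ) ^ 2) ^ a * Real.log H) ≤ C * (n : ℝ) ^ e * Real.log H := by
      rw [mul_assoc]; gcongr
    nlinarith [mul_le_mul_of_nonneg_right hn hlog0.le]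
  linarith [hmeas, hdist, key]

/-- **The common-field clause of `EPiSimultaneousTypeEv` is load-bearing**, modulo the
coordinatewise linear approximability `hB` of `(π, e)` (in print: Bugeaud 2003 + `e ∈ S`): the
eventual measure with `[ℚ(γ):ℚ] ≤ d` deleted (only the per-coordinate integer-polynomial clause
kept) fails for every `a < 1` and every `b`, `C > 0` — the challengers of `hB` at level `n` come
past any threshold `H₀(n)`. [folklore] -/
theorem epiSimultaneousTypeEv_false_without_fieldDegree_of_coordLinear
    (hB : ∃ c : ℝ, 0 < c ∧ ∀ n : ℕ, 1 ≤ n → ∀ H₀ : ℕ, ∃ H : ℕ, H₀ ≤ H ∧ ∃ α : Fin 2 → ℂ,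
      (∀ i, ∃ P : Polynomial ℤ, P ≠ 0 ∧ P.natDegree ≤ n ∧ (∀ k, |P.coeff k| ≤ (H : ℤ)) ∧
        Polynomial.aeval (α i) P = 0) ∧
      ‖α - ![(Real.pi : ℂ), (Real.exp 1 : ℂ)]‖ ≤ (H : ℝ) ^ (-(c * n))) :
    ¬ ∃ a b C : ℝ, a < 1 ∧ 0 < C ∧ ∀ d : ℕ, ∃ H₀ : ℕ, ∀ (H : ℕ) (γ : Fin 2 → ℂ), H₀ ≤ H →
      (∀ i, ∃ P : Polynomial ℤ, P ≠ 0 ∧ P.natDegree ≤ d ∧ (∀ k, |P.coeff k| ≤ (H : ℤ)) ∧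
        Polynomial.aeval (γ i) P = 0) →
      Real.exp (-(C * ((d : ℝ) ^ a * Real.log H + (d : ℝ) ^ b))) ≤
        ‖γ - ![(Real.pi : ℂ), (Real.exp 1 : ℂ)]‖ := by
  rintro ⟨a, b, C, ha, hC, hM⟩
  obtain ⟨c, hc, hB⟩ := hB
  set e : ℝ := max a 0 with hedef
  have he0 : 0 ≤ e := le_max_right _ _
  have he1 : e < 1 := max_lt ha one_pos
  have hae : a ≤ e := le_max_left _ _
  obtain ⟨n, hn1, hn⟩ := exists_nat_linear_beats_rpow (C' := C) hc he0 he1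
  obtain ⟨H₀, hH₀⟩ := hM n
  obtain ⟨H, hH0, α, hcl, hdist⟩ := hB n hn1 (max H₀ (⌈Real.exp (C * (n : ℝ) ^ b)⌉₊ + 2))
  have hH0' : H₀ ≤ H := (le_max_left _ _).trans hH0
  have hH0'' : ⌈Real.exp (C * (n : ℝ) ^ b)⌉₊ + 2 ≤ H := (le_max_right _ _).trans hH0
  have hn1' : (1 : ℝ) ≤ n := by exact_mod_cast hn1
  have hH2 : (2 : ℝ) ≤ H := by
    have : (2 : ℕ) ≤ H := le_trans (Nat.le_add_left 2 _) hH0''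
    exact_mod_cast this
  have hHpos : (0 : ℝ) < H := by linarith
  have hlogH : C * (n : ℝ) ^ b < Real.log H := by
    have h1 : Real.exp (C * (n : ℝ) ^ b) ≤ ⌈Real.exp (C * (n : ℝ) ^ b)⌉₊ := Nat.le_ceil _
    have h2 : ((⌈Real.exp (C * (n : ℝ) ^ b)⌉₊ + 2 : ℕ) : ℝ) ≤ H := by exact_mod_cast hH0''
    push_cast at h2
    rw [← Real.exp_lt_exp, Real.exp_log hHpos]
    linarith
  have hmeas := hH₀ H α hH0' hcl
  -- the bound beats H^{-cn}
  have key : (H : ℝ) ^ (-(c * n)) <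
      Real.exp (-(C * ((n : ℝ) ^ a * Real.log H + (n : ℝ) ^ b))) := by
    rw [Real.rpow_def_of_pos hHpos, Real.exp_lt_exp]
    have hna : (n : ℝ) ^ a ≤ (n : ℝ) ^ e := Real.rpow_le_rpow_of_exponent_le hn1' hae
    have hlog0 : 0 < Real.log H := Real.log_pos (by linarith)
    have h1 : C * ((n : ℝ) ^ a * Real.log H) ≤ C * (n : ℝ) ^ e * Real.log H := by
      rw [mul_assoc]; gcongr
    nlinarith [mul_le_mul_of_nonneg_right hn hlog0.le]
  linarith [hmeas, hdist, key]

end Summit.Schanuel.Schanuel.Theorems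

end
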